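import Summits.QuantumFields.BalabanUV.T4Continuum.Spine.NE1p.DressedSmallFieldOnCoresSlot
import Summits.QuantumFields.BalabanUV.T4Continuum.Spine.NE1p.DressedSmallFieldGeometryFaces

/-!
# T⁴ programme, spine estimate NE1′ (node O3b/H2) — THE SUBSTRATE-SLOT ENDs OF N0r WITHOUT A RADIUS BINDER AND WITHOUT A
# GEOMETRY HYPOTHESIS: N0r's `attachedPart_locE_le_of_coresAt_pencil_mass` (cores with term-dependent polymer families, (B3) as
# N0q's letter budget) and `attachedPart_locE_le_of_actOfLetters` (the substrate's activity slot of record, `hact` by `rfl`) in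
# ϱ-free form over a `B13Resummation.Geometry` (N0m §4b's SHARP room 3) and on pv22's `tgeometry 4 N` with located numerals

Cell `pub-balaban`, sub-cell `t4`, BINDER-OWNERS row NE1′ (owner lineage t4-ne1p-p1); crew seat `b2b-balaban-t4-ne1p-formalise-leaf-05`
(LEAF PROVER 05, generation 10); crew FACE row (INTENT `CLAIMS.log` 2026-08-20 16:24Z; leaf-03-g10 «leaf-05 takes N0r's faces»).
ADDITIVE — imports the owner's N0r `Spine/NE1p/DressedSmallFieldOnCoresSlot` (⇒ N0q `DressedSmallFieldOnCoresMass` ⇒ N0p ⇒ N0o ⇒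
N0m v1.2; the substrate cell's `Support/SubstrateActivities`) and crew row S24 `Spine/NE1p/DressedSmallFieldGeometryFaces` (for
`K₀_four`) ONLY; THEOREMS ONLY (+ one `example`; 0 `def`, 0 `def … : Prop`); nothing of N0r ∕ N0q ∕ N0p ∕ N0o ∕ N0m ∕ S24–S27 ∕ the
substrate ∕ row NE5 restated.

WHY THIS FILE.  N0r closes (B1b)'s `hact` by `rfl` on the substrate's slot activities `actOfLetters ℓ`, but both of its ENDs keep
(i) a `G : B13Resummation.Geometry` with the clauses at `G`'s letters (`hrate : r₁ + 2·G.κ₀ + 2 ≤ R`,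
`hsmall : (A₀ + ϱA₁)·e^{b₅+1}·G.K₀·G.ν·G.c₁ ≤ 1`) and (ii) N0m §2's radius conditions `hϱ : 2 ≤ ϱ`, `hϱA : A₀ ≤ ϱ·A₁`.  After N0o ∕ S24
∕ S25 ∕ S26 ∕ S27 (and leaf-03's N0q faces) every OTHER small-field END has a form with NO geometry hypothesis on the tree's
CONSTRUCTED torus geometry and a ϱ-FREE form.  THIS FILE wires the same for N0r, nothing else — the S24–S27 pattern verbatim:
* §1 over ONE `G : Geometry D Cube`: `attachedPart_locE_le_of_actOfLetters_printClause_three` — N0r §3 at the pencil radius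
  `ϱ⋆ := max 2 (A₀/A₁)` with `hϱ` ∕ `hϱA` ∕ `hsmall` SUPPLIED BY NAME by N0m's `two_le_pencilRadius` ∕ `intercept_le_pencilRadius_mul` ∕
  `pencilClause_of_printClause_three` under a live slope `0 < A₁ ≤ A₀` and `h3 : 3·A₀·(e^{b₅+1}·G.K₀·G.ν·G.c₁) ≤ 1`; the class radius
  `hH` and (B3)'s growth letter are READ AT `ϱ⋆` (not eliminable, as in N0m's own ϱ-free ENDs).
* §2 at `tgeometry 4 N` (pv22; `D := tsys 4 N`, d_{k+1} = `torusTreeLen`, incompatibility `TTouch`; all fields PROVED there), constants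
  LOCATED AS NUMERALS (N0o `torus_consts` + S24 `K₀_four`: ν = 9, κ₀ = 64·log 162, c₁ = 64, K₀ = `B12TreeDecay.K₀ 64 8`; print's (2.27)
  `c = 5` through N0r's `hb` at `b₅ = 5·r₁`): `attachedPart_locE_le_of_coresAt_pencil_mass_torus` (N0r §2, general ϱ),
  `attachedPart_locE_le_of_actOfLetters_torus` (N0r §3, general ϱ), `attachedPart_locE_le_of_actOfLetters_printClause_three_torus` (§1 on
  the torus — NO geometry hypothesis, NO radius binder) and the source-pencil twin `muPart_locE_le_of_actOfLetters_torus` (N0r §3's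
  μ-part END, general `0 < μ₀ < μ₁`); conclusions LITERALLY the right-hand side of S25's `attachedPart_locE_le_torus` ∕ S26 ∕ S27
  (one currency) and, for the μ-part, N0o's `muPart_locE_le_torus` currency `e·9·64·K₀(64,8)²·A·e^{−r₁·torusTreeLen X₀}·μ₀/(μ₁ − μ₀)`.
* §3 one `example` — THE COMMUTING SQUARE IN KERNEL: §2's `attachedPart_locE_le_of_actOfLetters_torus` IS §2's
  `attachedPart_locE_le_of_coresAt_pencil_mass_torus` at `𝔊 k p X := coreOf ℓ p.1 p.2` with `hact` by `rfl` (N0r §3's own proof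
  transplanted to the torus: slot-then-torus = torus-then-slot) — NO new inequality.
WHAT STAYS DISPLAYED (binders, by name; NOTHING instantiated on Bałaban's densities): the room `hroom`; the operator conditions
`hm`∕`hN`∕`hq` of the substrate's SUPPLIED Gaussian letters (rows NE2∕NE3's data, row NE5's factor-letter blocks); the class radii
`hO`∕`hH`; (B1b)'s residue `terms`∕`emb`∕`hscale`; (B3) as N0q's LETTER budget `hM3` (= GAPS G-ne9p2-5 read in row NE5's `paramMass`
currency, UNPRINTED, shared with NE9; a BINDER, never `[cite:`-tagged); `hA₀`, `hA₁` (`0 < A₁`, `A₁ ≤ A₀` for the ϱ-free forms), `hr₁`,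
and the located clauses «κ large» `r₁ + 2·(64·log 162) + 2 ≤ R` and «ε₁ small» in one of the SHAPES `(A₀ + ϱA₁)·E ≤ 1` ∕ `3·A₀·E ≤ 1`,
`E = e^{5r₁+1}·K₀(64,8)·9·64` ((B5): the SHAPES and the factor `3` are the owner's arithmetic consumed BY NAME, not re-derived; their
standing against print's NUMBERS is untouched).  (B4) is discharged BY NAME on pv22's CONSTRUCTED torus geometry; the identification of
`tsys 4 N` ∕ `torusTreeLen` with Bałaban's 𝐃_{k+1} ∕ d_{k+1} is pv22's READING (DIVERGENCE D-pv22.3), not asserted here — statements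
about typed SHAPES; no wall item moves; the wall line (v1.7 of record) does NOT move; R-t4r2-Q2 NOT met thereby.
HONEST FRAMING.  Kernel bookkeeping; the cores ∕ letters ∕ `actOfLetters` are the cell's typed FORMAT of (2.14) and the substrate's slot
of record, NOT Bałaban's functions; printed loci ([Balaban1988RGII] (2.14) p. 15, (2.18) p. 16, (1.26) p. 8, (2.27) ∕ (2.30) p. 18,
(2.38) p. 20, p. 21; [Balaban1987RGI] p. 251, p. 257) are TYPE ∕ CONTEXT through the imported [cite]-tagged Literature modules,
re-asserted nowhere; ABSOLUTE RULE honoured ([folklore] kernel lemmas only).  NE1′ ⇐ the named binders — NOT printed, NOT proved;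
0 leaves instantiated on Bałaban's densities; spine PROVED 0∕9; count 9 unchanged.  Rung (B)+1 on ONE finite four-torus — NOT infinite
volume, NOT a mass gap, NOT OS on ℝ⁴, NOT Clay.  HONEST DEPENDENCY: continuum YM on T⁴ ⇐ BetaPertH ∧ nine spine estimates (0/9
proved); BetaPertH ⇐ (D1) ∧ (D4) ∧ CAP+tail; G-an2-4 gates asym, D1 and NE2/3/4.
-/
noncomputable section

namespace Summit.QuantumFields.BalabanUV.T4Continuum.NE1p.DressedSmallFieldOnCoresSlotFaces

open Metric Set Complex MeasureTheory
open scoped BigOperators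
open Literature.MathematicalPhysics.QuantumFieldTheory.Balaban1983to89 (LocDomainSys)
open Literature.MathematicalPhysics.QuantumFieldTheory.Balaban1983to89.T4OutputRate (Carriers)
open Literature.MathematicalPhysics.QuantumFieldTheory.Balaban1983to89.B13Resummation (locE Geometry)
open Literature.MathematicalPhysics.QuantumFieldTheory.Balaban1983to89.TreeLengthTorus (tsys torusTreeLen)
open Literature.MathematicalPhysics.QuantumFieldTheory.Balaban1983to89.TreeLengthTorusGeometry (TTouch tgeometry)
open Literature.MathematicalPhysics.QuantumFieldTheory.Balaban1983to89.B12TreeDecay (K₀ K₀_pos)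
open Summit.QuantumFields.BalabanUV.T4Continuum.B13HistMeasurable (MeasPotFrame B13HistM)
open Summit.QuantumFields.BalabanUV.T4Continuum.B13TermParamGaussianBi (BiCore)
open Summit.QuantumFields.BalabanUV.T4Continuum.SubstrateActivities (CoreLetters coreOf actOfLetters)
open Summit.QuantumFields.BalabanUV.T4Continuum.NE1p.DressedSmallFieldOnCoresSlot (attachedPart_locE_le_of_coresAt_pencil_mass
  attachedPart_locE_le_of_actOfLetters muPart_locE_le_of_actOfLetters)
open Summit.QuantumFields.BalabanUV.T4Continuum.NE1p.DressedSmallFieldInduction (two_le_pencilRadius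
  intercept_le_pencilRadius_mul pencilClause_of_printClause_three)
open Summit.QuantumFields.BalabanUV.T4Continuum.NE1p.DressedSmallFieldGeometry (torus_consts)
open Summit.QuantumFields.BalabanUV.T4Continuum.NE1p.DressedSmallFieldGeometryFaces (K₀_four)

/-! ## §1 THE ϱ-FREE FORM OF THE SLOT END OVER A `B13Resummation.Geometry` — N0m §4∕§4b's arithmetic BY NAME (sharp room 3) -/

section OfGeometry

variable {C : Carriers} (P : MeasPotFrame C) (Op : Type*) [NormedAddCommGroup Op] [NormedSpace ℂ Op] {Pol J : Type*}
  (𝒴 : Pol → J → Type) [∀ Z j, Fintype (𝒴 Z j)] (dom : ∀ Z j, 𝒴 Z j → C.Dom)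
  (Jc : Pol → J → Type) [∀ Z j, Fintype (Jc Z j)]
  (V : Pol → J → Type) [∀ Z j, NormedAddCommGroup (V Z j)] [∀ Z j, InnerProductSpace ℝ (V Z j)]
  [∀ Z j, MeasurableSpace (V Z j)] [∀ Z j, BorelSpace (V Z j)] [∀ Z j, FiniteDimensional ℝ (V Z j)]
variable (D : LocDomainSys) {Cube : Type} [DecidableEq Cube] (G : Geometry D Cube)

open Classical in
/-- **THE SLOT END UNDER PRINT'S CLAUSE WITH THE SHARP FACTOR-3 ROOM — NO RADIUS BINDER** (kernel; N0r §3
`attachedPart_locE_le_of_actOfLetters` BY NAME at the pencil radius `ϱ⋆ := max 2 (A₀/A₁)`, its `hϱ` ∕ `hϱA` ∕ `hsmall` SUPPLIED by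
N0m §4∕§4b's `two_le_pencilRadius` ∕ `intercept_le_pencilRadius_mul` ∕ `pencilClause_of_printClause_three` BY NAME): for a live
attached slope `0 < A₁ ≤ A₀`, «κ large» `hrate`, «ε₁ small AT THE UNDRESSED CONSTANT with the sharp factor-3 room»
`h3 : 3·A₀·(e^{b₅+1}·G.K₀·G.ν·G.c₁) ≤ 1` — the remaining binders being N0r's verbatim (room, the substrate letters' operator conditions,
class radii with `hH` READ AT `ϱ⋆`, `terms`∕`emb`∕`hscale`, (B3)'s letter budget `hM3` READ AT `ϱ⋆`) — the attached part of the
slot activities is `≤ 4·(e·G.ν·G.c₁·G.K₀²)·A₁·e^{−r₁ d(X₀)}`. [folklore] -/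
theorem attachedPart_locE_le_of_actOfLetters_printClause_three {W : Set (ℕ → ℝ)}
    {ctr : ℕ → (ℕ → ℝ) → C.BgB → Op × B13HistM P} {ROp RHist R' : ℕ → ℝ} (ℓ : ∀ Z j, CoreLetters P Op 𝒴 dom Jc V Z j)
    {mq bq N₀ : ℕ → Pol × J → C.Dom → ℝ} (hroom : ∀ k, ROp k < R' k)
    (hm : ∀ k, ∀ g ∈ W, ∀ (U : C.BgB) (X : C.Dom), C.scale X = k → ∀ p, 0 < mq k p X)
    (hN : ∀ k, ∀ g ∈ W, ∀ (U : C.BgB) (X : C.Dom), C.scale X = k → ∀ p : Pol × J,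
      (∀ o ∈ ball (ctr k g U).1 (R' k),
        AEStronglyMeasurable ((ℓ p.1 p.2).N o) (coreOf P Op 𝒴 dom Jc V ℓ p.1 p.2).lam) ∧
      (∀ a, DifferentiableOn ℂ (fun o => (ℓ p.1 p.2).N o a) (ball (ctr k g U).1 (R' k))) ∧
      (∀ o ∈ ball (ctr k g U).1 (R' k), ∀ a, ‖(ℓ p.1 p.2).N o a‖ ≤ N₀ k p X))
    (hq : ∀ k, ∀ g ∈ W, ∀ (U : C.BgB) (X : C.Dom), C.scale X = k → ∀ p : Pol × J,
      (∀ o ∈ ball (ctr k g U).1 (R' k),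
        AEStronglyMeasurable (Function.uncurry ((ℓ p.1 p.2).q o))
          ((coreOf P Op 𝒴 dom Jc V ℓ p.1 p.2).lam.prod volume)) ∧
      (∀ a v, DifferentiableOn ℂ (fun o => (ℓ p.1 p.2).q o a v) (ball (ctr k g U).1 (R' k))) ∧
      (∀ o ∈ ball (ctr k g U).1 (R' k), ∀ a v, mq k p X * ‖v‖ ^ 2 - bq k p X ≤ ((ℓ p.1 p.2).q o a v).re))
    {k : ℕ} {g : ℕ → ℝ} (hg : g ∈ W) {U : C.BgB} {o : Op} {h₀ w : B13HistM P} {A₀ A₁ : ℝ}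
    (hO : ‖o - (ctr k g U).1‖ ≤ ROp k) (hH : ‖h₀ - (ctr k g U).2‖ + max 2 (A₀ / A₁) * ‖w‖ ≤ RHist k)
    {emb : D.Dom → C.Dom} (hscale : ∀ Z, C.scale (emb Z) = k) (terms : D.Dom → Finset (Pol × J))
    {R r₁ b₅ : ℝ} {X₀ : D.Dom} (hA₀ : 0 ≤ A₀) (hA₁ : 0 < A₁) (hle : A₁ ≤ A₀) (hr₁ : 0 ≤ r₁) (hb : r₁ * 5 ≤ b₅)
    (hrate : r₁ + 2 * G.κ₀ + 2 ≤ R) (h3 : 3 * A₀ * (Real.exp (b₅ + 1) * G.K₀ * G.ν * G.c₁) ≤ 1)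
    (hM3 : ∀ Z, G.cubes Z ⊆ G.cubes X₀ →
      ∑ p ∈ terms Z, (coreOf P Op 𝒴 dom Jc V ℓ p.1 p.2).lam.real univ *
          ((coreOf P Op 𝒴 dom Jc V ℓ p.1 p.2).wB * N₀ k p (emb Z) * Real.exp (bq k p (emb Z))) *
          (Real.pi / (mq k p (emb Z) / 2)) ^ (Module.finrank ℝ (V p.1 p.2) / 2 : ℝ) *
        Real.exp ((coreOf P Op 𝒴 dom Jc V ℓ p.1 p.2).N₁ * (‖h₀‖ + max 2 (A₀ / A₁) * ‖w‖)) ≤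
          (A₀ + max 2 (A₀ / A₁) * A₁) * Real.exp (-(R * D.dj Z))) :
    ‖locE G.ι G.cubes (fun Z => ∑ p ∈ terms Z, actOfLetters P Op 𝒴 dom Jc V ℓ p.1 p.2 o (h₀ + w)) (G.cubes X₀) -
        locE G.ι G.cubes (fun Z => ∑ p ∈ terms Z, actOfLetters P Op 𝒴 dom Jc V ℓ p.1 p.2 o h₀) (G.cubes X₀)‖ ≤
      4 * (Real.exp 1 * G.ν * G.c₁ * G.K₀ ^ 2) * A₁ * Real.exp (-(r₁ * D.dj X₀)) := by
  have hE : 0 ≤ Real.exp (b₅ + 1) * G.K₀ * G.ν * G.c₁ :=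
    mul_nonneg (mul_nonneg (mul_nonneg (Real.exp_nonneg _) G.K₀_nonneg) G.ν_nonneg) G.c₁_nonneg
  have hsmall : (A₀ + max 2 (A₀ / A₁) * A₁) * Real.exp (b₅ + 1) * G.K₀ * G.ν * G.c₁ ≤ 1 := by
    simpa only [mul_assoc] using pencilClause_of_printClause_three hA₁ hle hE h3
  exact attachedPart_locE_le_of_actOfLetters P Op 𝒴 dom Jc V D G ℓ hroom hm hN hq hg hO hH hscale terms hA₀ hA₁.le hr₁ hb
    hrate hsmall hM3 (two_le_pencilRadius A₀ A₁) (intercept_le_pencilRadius_mul hA₁)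

end OfGeometry

/-! ## §2 ON THE TORUS OF THE PAPERS (pv22's `tgeometry 4 N`): NO geometry hypothesis, clauses LOCATED AS NUMERALS (S24–S27 §2
pattern: ν = 9, κ₀ = 64·log 162, c₁ = 64, K₀ = `B12TreeDecay.K₀ 64 8`, print's (2.27) `c = 5`, `b₅ = 5·r₁`) -/

section Torus

variable {N : ℕ} [NeZero N]

section Dep

variable {C : Carriers} {P : MeasPotFrame C} {Op : Type*} [NormedAddCommGroup Op] [NormedSpace ℂ Op] {ι : Type*}
  {𝒴 : ℕ → ι → Type*} {dom : ∀ k i, 𝒴 k i → C.Dom} {β : ℕ → ι → Type*} [∀ k i, MeasurableSpace (β k i)]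
  {α : ℕ → ι → Type*} [∀ k i, NormedAddCommGroup (α k i)] [∀ k i, InnerProductSpace ℝ (α k i)]
  [∀ k i, FiniteDimensional ℝ (α k i)] [∀ k i, MeasurableSpace (α k i)] [∀ k i, BorelSpace (α k i)]

open Classical in
/-- **THE TERM-DEPENDENT CORES END ALONG THE LINEAR PENCIL ON THE TORUS, (B3) AS A LETTER BUDGET — NO GEOMETRY HYPOTHESIS** (kernel;
N0r §2 `attachedPart_locE_le_of_coresAt_pencil_mass` at `D := tsys 4 N`, `G := tgeometry 4 N`, constants located by N0o `torus_consts` +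
S24 `K₀_four`): for cores `𝔊 k i X : BiCore P (dom k i) Op (β k i) (α k i)` with term-dependent polymer families, the operator letters
`hm`∕`hN`∕`hq`, room `hroom`, pencil `h₀ + s•w` with the two radius inequalities, indexing `hact`, the located clauses, N0m's `hϱ`∕`hϱA`
and (B3) as the LETTER budget `hM3`: the attached part on a torus domain `X₀` is `≤ 4·(e·9·64·K₀(64,8)²)·A₁·e^{−r₁·torusTreeLen X₀}`
— LITERALLY the right-hand side of S25's `attachedPart_locE_le_torus`. [folklore] -/
theorem attachedPart_locE_le_of_coresAt_pencil_mass_torus {W : Set (ℕ → ℝ)}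
    {ctr : ℕ → (ℕ → ℝ) → C.BgB → Op × B13HistM P} {ROp RHist R' : ℕ → ℝ}
    (𝔊 : ∀ k i, C.Dom → BiCore P (dom k i) Op (β k i) (α k i)) {mq bq N₀ : ℕ → ι → C.Dom → ℝ} (hroom : ∀ k, ROp k < R' k)
    (hm : ∀ k, ∀ g ∈ W, ∀ (U : C.BgB) (X : C.Dom), C.scale X = k → ∀ i, 0 < mq k i X)
    (hN : ∀ k, ∀ g ∈ W, ∀ (U : C.BgB) (X : C.Dom), C.scale X = k → ∀ i,
      (∀ o ∈ ball (ctr k g U).1 (R' k), AEStronglyMeasurable ((𝔊 k i X).N o) (𝔊 k i X).lam) ∧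
      (∀ p, DifferentiableOn ℂ (fun o => (𝔊 k i X).N o p) (ball (ctr k g U).1 (R' k))) ∧
      (∀ o ∈ ball (ctr k g U).1 (R' k), ∀ p, ‖(𝔊 k i X).N o p‖ ≤ N₀ k i X))
    (hq : ∀ k, ∀ g ∈ W, ∀ (U : C.BgB) (X : C.Dom), C.scale X = k → ∀ i,
      (∀ o ∈ ball (ctr k g U).1 (R' k),
        AEStronglyMeasurable (Function.uncurry ((𝔊 k i X).q o)) ((𝔊 k i X).lam.prod volume)) ∧
      (∀ p v, DifferentiableOn ℂ (fun o => (𝔊 k i X).q o p v) (ball (ctr k g U).1 (R' k))) ∧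
      (∀ o ∈ ball (ctr k g U).1 (R' k), ∀ p v, mq k i X * ‖v‖ ^ 2 - bq k i X ≤ ((𝔊 k i X).q o p v).re))
    {k : ℕ} {g : ℕ → ℝ} (hg : g ∈ W) {U : C.BgB} {o : Op} {h₀ w : B13HistM P} {ϱ : ℝ}
    (hO : ‖o - (ctr k g U).1‖ ≤ ROp k) (hH : ‖h₀ - (ctr k g U).2‖ + ϱ * ‖w‖ ≤ RHist k)
    {emb : (tsys 4 N).Dom → C.Dom} (hscale : ∀ Z, C.scale (emb Z) = k) {terms : (tsys 4 N).Dom → Finset ι}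
    {act : ℂ → (tsys 4 N).Dom → ℂ}
    (hact : ∀ s ∈ ball (0 : ℂ) ϱ, ∀ Z, act s Z = ∑ i ∈ terms Z, (𝔊 k i (emb Z)).termAt o (h₀ + s • w))
    {A₀ A₁ R r₁ : ℝ} (X₀ : (tsys 4 N).Dom) (hA₀ : 0 ≤ A₀) (hA₁ : 0 ≤ A₁) (hr₁ : 0 ≤ r₁)
    (hrate : r₁ + 2 * (64 * Real.log 162) + 2 ≤ R)
    (hsmall : (A₀ + ϱ * A₁) * Real.exp (5 * r₁ + 1) * K₀ 64 8 * 9 * 64 ≤ 1)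
    (hM3 : ∀ Z : (tsys 4 N).Dom, Z.1 ⊆ X₀.1 →
      ∑ i ∈ terms Z, (𝔊 k i (emb Z)).lam.real univ * ((𝔊 k i (emb Z)).wB * N₀ k i (emb Z) *
          Real.exp (bq k i (emb Z))) * (Real.pi / (mq k i (emb Z) / 2)) ^ (Module.finrank ℝ (α k i) / 2 : ℝ) *
        Real.exp ((𝔊 k i (emb Z)).N₁ * (‖h₀‖ + ϱ * ‖w‖)) ≤ (A₀ + ϱ * A₁) * Real.exp (-(R * torusTreeLen Z.1)))
    (hϱ : 2 ≤ ϱ) (hϱA : A₀ ≤ ϱ * A₁) :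
    ‖locE (TTouch (d := 4) (N := N)) (fun Z : (tsys 4 N).Dom => Z.1) (act 1) X₀.1 -
        locE (TTouch (d := 4) (N := N)) (fun Z : (tsys 4 N).Dom => Z.1) (act 0) X₀.1‖ ≤
      4 * (Real.exp 1 * 9 * 64 * K₀ 64 8 ^ 2) * A₁ * Real.exp (-(r₁ * torusTreeLen X₀.1)) := by
  obtain ⟨hν, hκ, hc⟩ := torus_consts N
  have hK₀ := K₀_four (N := N)
  have h := attachedPart_locE_le_of_coresAt_pencil_mass (tsys 4 N) (tgeometry 4 N) 𝔊 hroom hm hN hq hg hO hH hscale hact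
    (R := R) (b₅ := 5 * r₁) (X₀ := X₀) hA₀ hA₁ hr₁ (le_of_eq (by ring)) (by rw [hκ]; exact hrate)
    (by rw [hK₀, hν, hc]; exact hsmall) hM3 hϱ hϱA
  rw [hν, hc, hK₀] at h
  exact h

end Dep

section Slot

variable {C : Carriers} (P : MeasPotFrame C) (Op : Type*) [NormedAddCommGroup Op] [NormedSpace ℂ Op] {Pol J : Type*}
  (𝒴 : Pol → J → Type) [∀ Z j, Fintype (𝒴 Z j)] (dom : ∀ Z j, 𝒴 Z j → C.Dom)
  (Jc : Pol → J → Type) [∀ Z j, Fintype (Jc Z j)]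
  (V : Pol → J → Type) [∀ Z j, NormedAddCommGroup (V Z j)] [∀ Z j, InnerProductSpace ℝ (V Z j)]
  [∀ Z j, MeasurableSpace (V Z j)] [∀ Z j, BorelSpace (V Z j)] [∀ Z j, FiniteDimensional ℝ (V Z j)]

open Classical in
/-- **THE SLOT END ON THE TORUS — NO GEOMETRY HYPOTHESIS** (kernel; N0r §3 `attachedPart_locE_le_of_actOfLetters` at `tgeometry 4 N`,
constants located): for the substrate's letter families `ℓ Z j` with their operator conditions, class radii, (B1b)'s residue
`terms`∕`emb`∕`hscale`, the located clauses, N0m's `hϱ`∕`hϱA` and (B3) as N0q's letter budget on the substrate's cores: the attached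
part of `Σ_{p ∈ terms Z} actOfLetters ℓ p.1 p.2 o (h₀ + w)` against `… o h₀` on a torus domain `X₀` is
`≤ 4·(e·9·64·K₀(64,8)²)·A₁·e^{−r₁·torusTreeLen X₀}`. [folklore] -/
theorem attachedPart_locE_le_of_actOfLetters_torus {W : Set (ℕ → ℝ)}
    {ctr : ℕ → (ℕ → ℝ) → C.BgB → Op × B13HistM P} {ROp RHist R' : ℕ → ℝ} (ℓ : ∀ Z j, CoreLetters P Op 𝒴 dom Jc V Z j)
    {mq bq N₀ : ℕ → Pol × J → C.Dom → ℝ} (hroom : ∀ k, ROp k < R' k)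
    (hm : ∀ k, ∀ g ∈ W, ∀ (U : C.BgB) (X : C.Dom), C.scale X = k → ∀ p, 0 < mq k p X)
    (hN : ∀ k, ∀ g ∈ W, ∀ (U : C.BgB) (X : C.Dom), C.scale X = k → ∀ p : Pol × J,
      (∀ o ∈ ball (ctr k g U).1 (R' k),
        AEStronglyMeasurable ((ℓ p.1 p.2).N o) (coreOf P Op 𝒴 dom Jc V ℓ p.1 p.2).lam) ∧
      (∀ a, DifferentiableOn ℂ (fun o => (ℓ p.1 p.2).N o a) (ball (ctr k g U).1 (R' k))) ∧
      (∀ o ∈ ball (ctr k g U).1 (R' k), ∀ a, ‖(ℓ p.1 p.2).N o a‖ ≤ N₀ k p X))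
    (hq : ∀ k, ∀ g ∈ W, ∀ (U : C.BgB) (X : C.Dom), C.scale X = k → ∀ p : Pol × J,
      (∀ o ∈ ball (ctr k g U).1 (R' k),
        AEStronglyMeasurable (Function.uncurry ((ℓ p.1 p.2).q o))
          ((coreOf P Op 𝒴 dom Jc V ℓ p.1 p.2).lam.prod volume)) ∧
      (∀ a v, DifferentiableOn ℂ (fun o => (ℓ p.1 p.2).q o a v) (ball (ctr k g U).1 (R' k))) ∧
      (∀ o ∈ ball (ctr k g U).1 (R' k), ∀ a v, mq k p X * ‖v‖ ^ 2 - bq k p X ≤ ((ℓ p.1 p.2).q o a v).re))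
    {k : ℕ} {g : ℕ → ℝ} (hg : g ∈ W) {U : C.BgB} {o : Op} {h₀ w : B13HistM P} {ϱ : ℝ}
    (hO : ‖o - (ctr k g U).1‖ ≤ ROp k) (hH : ‖h₀ - (ctr k g U).2‖ + ϱ * ‖w‖ ≤ RHist k)
    {emb : (tsys 4 N).Dom → C.Dom} (hscale : ∀ Z, C.scale (emb Z) = k) (terms : (tsys 4 N).Dom → Finset (Pol × J))
    {A₀ A₁ R r₁ : ℝ} (X₀ : (tsys 4 N).Dom) (hA₀ : 0 ≤ A₀) (hA₁ : 0 ≤ A₁) (hr₁ : 0 ≤ r₁)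
    (hrate : r₁ + 2 * (64 * Real.log 162) + 2 ≤ R)
    (hsmall : (A₀ + ϱ * A₁) * Real.exp (5 * r₁ + 1) * K₀ 64 8 * 9 * 64 ≤ 1)
    (hM3 : ∀ Z : (tsys 4 N).Dom, Z.1 ⊆ X₀.1 →
      ∑ p ∈ terms Z, (coreOf P Op 𝒴 dom Jc V ℓ p.1 p.2).lam.real univ *
          ((coreOf P Op 𝒴 dom Jc V ℓ p.1 p.2).wB * N₀ k p (emb Z) * Real.exp (bq k p (emb Z))) *
          (Real.pi / (mq k p (emb Z) / 2)) ^ (Module.finrank ℝ (V p.1 p.2) / 2 : ℝ) *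
        Real.exp ((coreOf P Op 𝒴 dom Jc V ℓ p.1 p.2).N₁ * (‖h₀‖ + ϱ * ‖w‖)) ≤ (A₀ + ϱ * A₁) * Real.exp (-(R * torusTreeLen Z.1)))
    (hϱ : 2 ≤ ϱ) (hϱA : A₀ ≤ ϱ * A₁) :
    ‖locE (TTouch (d := 4) (N := N)) (fun Z : (tsys 4 N).Dom => Z.1)
          (fun Z => ∑ p ∈ terms Z, actOfLetters P Op 𝒴 dom Jc V ℓ p.1 p.2 o (h₀ + w)) X₀.1 -
        locE (TTouch (d := 4) (N := N)) (fun Z : (tsys 4 N).Dom => Z.1)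
          (fun Z => ∑ p ∈ terms Z, actOfLetters P Op 𝒴 dom Jc V ℓ p.1 p.2 o h₀) X₀.1‖ ≤
      4 * (Real.exp 1 * 9 * 64 * K₀ 64 8 ^ 2) * A₁ * Real.exp (-(r₁ * torusTreeLen X₀.1)) := by
  obtain ⟨hν, hκ, hc⟩ := torus_consts N
  have hK₀ := K₀_four (N := N)
  have h := attachedPart_locE_le_of_actOfLetters P Op 𝒴 dom Jc V (tsys 4 N) (tgeometry 4 N) ℓ hroom hm hN hq hg hO hH hscale
    terms (R := R) (b₅ := 5 * r₁) (X₀ := X₀) hA₀ hA₁ hr₁ (le_of_eq (by ring)) (by rw [hκ]; exact hrate)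
    (by rw [hK₀, hν, hc]; exact hsmall) hM3 hϱ hϱA
  rw [hν, hc, hK₀] at h
  exact h

open Classical in
/-- **THE SLOT END ON THE TORUS, ϱ-FREE — NO GEOMETRY HYPOTHESIS, NO RADIUS BINDER** (kernel; §1's
`attachedPart_locE_le_of_actOfLetters_printClause_three` at `tgeometry 4 N`, constants located): live slope `0 < A₁ ≤ A₀`, «κ large»
`r₁ + 2·(64·log 162) + 2 ≤ R`, «ε₁ small with the sharp factor-3 room» `3·A₀·(e^{5r₁+1}·K₀(64,8)·9·64) ≤ 1`, the class radius `hH`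
and (B3)'s growth letter READ AT `ϱ⋆ = max 2 (A₀/A₁)` ⇒ the same located bound. [folklore] -/
theorem attachedPart_locE_le_of_actOfLetters_printClause_three_torus {W : Set (ℕ → ℝ)}
    {ctr : ℕ → (ℕ → ℝ) → C.BgB → Op × B13HistM P} {ROp RHist R' : ℕ → ℝ} (ℓ : ∀ Z j, CoreLetters P Op 𝒴 dom Jc V Z j)
    {mq bq N₀ : ℕ → Pol × J → C.Dom → ℝ} (hroom : ∀ k, ROp k < R' k)
    (hm : ∀ k, ∀ g ∈ W, ∀ (U : C.BgB) (X : C.Dom), C.scale X = k → ∀ p, 0 < mq k p X)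
    (hN : ∀ k, ∀ g ∈ W, ∀ (U : C.BgB) (X : C.Dom), C.scale X = k → ∀ p : Pol × J,
      (∀ o ∈ ball (ctr k g U).1 (R' k),
        AEStronglyMeasurable ((ℓ p.1 p.2).N o) (coreOf P Op 𝒴 dom Jc V ℓ p.1 p.2).lam) ∧
      (∀ a, DifferentiableOn ℂ (fun o => (ℓ p.1 p.2).N o a) (ball (ctr k g U).1 (R' k))) ∧
      (∀ o ∈ ball (ctr k g U).1 (R' k), ∀ a, ‖(ℓ p.1 p.2).N o a‖ ≤ N₀ k p X))
    (hq : ∀ k, ∀ g ∈ W, ∀ (U : C.BgB) (X : C.Dom), C.scale X = k → ∀ p : Pol × J,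
      (∀ o ∈ ball (ctr k g U).1 (R' k),
        AEStronglyMeasurable (Function.uncurry ((ℓ p.1 p.2).q o))
          ((coreOf P Op 𝒴 dom Jc V ℓ p.1 p.2).lam.prod volume)) ∧
      (∀ a v, DifferentiableOn ℂ (fun o => (ℓ p.1 p.2).q o a v) (ball (ctr k g U).1 (R' k))) ∧
      (∀ o ∈ ball (ctr k g U).1 (R' k), ∀ a v, mq k p X * ‖v‖ ^ 2 - bq k p X ≤ ((ℓ p.1 p.2).q o a v).re))
    {k : ℕ} {g : ℕ → ℝ} (hg : g ∈ W) {U : C.BgB} {o : Op} {h₀ w : B13HistM P} {A₀ A₁ : ℝ}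
    (hO : ‖o - (ctr k g U).1‖ ≤ ROp k) (hH : ‖h₀ - (ctr k g U).2‖ + max 2 (A₀ / A₁) * ‖w‖ ≤ RHist k)
    {emb : (tsys 4 N).Dom → C.Dom} (hscale : ∀ Z, C.scale (emb Z) = k) (terms : (tsys 4 N).Dom → Finset (Pol × J))
    {R r₁ : ℝ} (X₀ : (tsys 4 N).Dom) (hA₀ : 0 ≤ A₀) (hA₁ : 0 < A₁) (hle : A₁ ≤ A₀) (hr₁ : 0 ≤ r₁)
    (hrate : r₁ + 2 * (64 * Real.log 162) + 2 ≤ R) (h3 : 3 * A₀ * (Real.exp (5 * r₁ + 1) * K₀ 64 8 * 9 * 64) ≤ 1)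
    (hM3 : ∀ Z : (tsys 4 N).Dom, Z.1 ⊆ X₀.1 →
      ∑ p ∈ terms Z, (coreOf P Op 𝒴 dom Jc V ℓ p.1 p.2).lam.real univ *
          ((coreOf P Op 𝒴 dom Jc V ℓ p.1 p.2).wB * N₀ k p (emb Z) * Real.exp (bq k p (emb Z))) *
          (Real.pi / (mq k p (emb Z) / 2)) ^ (Module.finrank ℝ (V p.1 p.2) / 2 : ℝ) *
        Real.exp ((coreOf P Op 𝒴 dom Jc V ℓ p.1 p.2).N₁ * (‖h₀‖ + max 2 (A₀ / A₁) * ‖w‖)) ≤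
          (A₀ + max 2 (A₀ / A₁) * A₁) * Real.exp (-(R * torusTreeLen Z.1))) :
    ‖locE (TTouch (d := 4) (N := N)) (fun Z : (tsys 4 N).Dom => Z.1)
          (fun Z => ∑ p ∈ terms Z, actOfLetters P Op 𝒴 dom Jc V ℓ p.1 p.2 o (h₀ + w)) X₀.1 -
        locE (TTouch (d := 4) (N := N)) (fun Z : (tsys 4 N).Dom => Z.1)
          (fun Z => ∑ p ∈ terms Z, actOfLetters P Op 𝒴 dom Jc V ℓ p.1 p.2 o h₀) X₀.1‖ ≤
      4 * (Real.exp 1 * 9 * 64 * K₀ 64 8 ^ 2) * A₁ * Real.exp (-(r₁ * torusTreeLen X₀.1)) := by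
  obtain ⟨hν, hκ, hc⟩ := torus_consts N
  have hK₀ := K₀_four (N := N)
  have h := attachedPart_locE_le_of_actOfLetters_printClause_three P Op 𝒴 dom Jc V (tsys 4 N) (tgeometry 4 N) ℓ hroom hm hN hq
    hg hO hH hscale terms (R := R) (b₅ := 5 * r₁) (X₀ := X₀) hA₀ hA₁ hle hr₁ (le_of_eq (by ring)) (by rw [hκ]; exact hrate)
    (by rw [hK₀, hν, hc]; exact h3) hM3
  rw [hν, hc, hK₀] at h
  exact h

open Classical in
/-- **THE SLOT μ-PART ON THE TORUS — NO GEOMETRY HYPOTHESIS** (kernel; N0r §3's source-pencil twin `muPart_locE_le_of_actOfLetters` at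
`tgeometry 4 N`, constants located): along the SOURCE pencil `h₀ + s • v`, `‖s‖ ≤ μ₀ < μ₁`, with the class radius `hH` read at `μ₁`, the
located clauses at the constant `A` and (B3) as N0q's letter budget at `A`: the μ-part of the slot activities on a torus domain `X₀` is
`≤ e·9·64·K₀(64,8)²·A·e^{−r₁·torusTreeLen X₀}·μ₀/(μ₁ − μ₀)` — N0o's `muPart_locE_le_torus` ∕ S27's `muPart_locE_le_of_expLinear_torus` currency.
[folklore] -/
theorem muPart_locE_le_of_actOfLetters_torus {W : Set (ℕ → ℝ)}
    {ctr : ℕ → (ℕ → ℝ) → C.BgB → Op × B13HistM P} {ROp RHist R' : ℕ → ℝ} (ℓ : ∀ Z j, CoreLetters P Op 𝒴 dom Jc V Z j)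
    {mq bq N₀ : ℕ → Pol × J → C.Dom → ℝ} (hroom : ∀ k, ROp k < R' k)
    (hm : ∀ k, ∀ g ∈ W, ∀ (U : C.BgB) (X : C.Dom), C.scale X = k → ∀ p, 0 < mq k p X)
    (hN : ∀ k, ∀ g ∈ W, ∀ (U : C.BgB) (X : C.Dom), C.scale X = k → ∀ p : Pol × J,
      (∀ o ∈ ball (ctr k g U).1 (R' k),
        AEStronglyMeasurable ((ℓ p.1 p.2).N o) (coreOf P Op 𝒴 dom Jc V ℓ p.1 p.2).lam) ∧
      (∀ a, DifferentiableOn ℂ (fun o => (ℓ p.1 p.2).N o a) (ball (ctr k g U).1 (R' k))) ∧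
      (∀ o ∈ ball (ctr k g U).1 (R' k), ∀ a, ‖(ℓ p.1 p.2).N o a‖ ≤ N₀ k p X))
    (hq : ∀ k, ∀ g ∈ W, ∀ (U : C.BgB) (X : C.Dom), C.scale X = k → ∀ p : Pol × J,
      (∀ o ∈ ball (ctr k g U).1 (R' k),
        AEStronglyMeasurable (Function.uncurry ((ℓ p.1 p.2).q o))
          ((coreOf P Op 𝒴 dom Jc V ℓ p.1 p.2).lam.prod volume)) ∧
      (∀ a v, DifferentiableOn ℂ (fun o => (ℓ p.1 p.2).q o a v) (ball (ctr k g U).1 (R' k))) ∧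
      (∀ o ∈ ball (ctr k g U).1 (R' k), ∀ a v, mq k p X * ‖v‖ ^ 2 - bq k p X ≤ ((ℓ p.1 p.2).q o a v).re))
    {k : ℕ} {g : ℕ → ℝ} (hg : g ∈ W) {U : C.BgB} {o : Op} {h₀ v : B13HistM P} {μ₁ : ℝ}
    (hO : ‖o - (ctr k g U).1‖ ≤ ROp k) (hH : ‖h₀ - (ctr k g U).2‖ + μ₁ * ‖v‖ ≤ RHist k)
    {emb : (tsys 4 N).Dom → C.Dom} (hscale : ∀ Z, C.scale (emb Z) = k) (terms : (tsys 4 N).Dom → Finset (Pol × J))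
    {A R r₁ μ₀ : ℝ} (X₀ : (tsys 4 N).Dom) {sμ : ℂ} (hA : 0 ≤ A) (hr₁ : 0 ≤ r₁)
    (hrate : r₁ + 2 * (64 * Real.log 162) + 2 ≤ R) (hsmall : A * Real.exp (5 * r₁ + 1) * K₀ 64 8 * 9 * 64 ≤ 1)
    (hM3 : ∀ Z : (tsys 4 N).Dom, Z.1 ⊆ X₀.1 →
      ∑ p ∈ terms Z, (coreOf P Op 𝒴 dom Jc V ℓ p.1 p.2).lam.real univ *
          ((coreOf P Op 𝒴 dom Jc V ℓ p.1 p.2).wB * N₀ k p (emb Z) * Real.exp (bq k p (emb Z))) *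
          (Real.pi / (mq k p (emb Z) / 2)) ^ (Module.finrank ℝ (V p.1 p.2) / 2 : ℝ) *
        Real.exp ((coreOf P Op 𝒴 dom Jc V ℓ p.1 p.2).N₁ * (‖h₀‖ + μ₁ * ‖v‖)) ≤ A * Real.exp (-(R * torusTreeLen Z.1)))
    (h0 : 0 < μ₀) (h01 : μ₀ < μ₁) (hμ : ‖sμ‖ ≤ μ₀) :
    ‖locE (TTouch (d := 4) (N := N)) (fun Z : (tsys 4 N).Dom => Z.1)
          (fun Z => ∑ p ∈ terms Z, actOfLetters P Op 𝒴 dom Jc V ℓ p.1 p.2 o (h₀ + sμ • v)) X₀.1 -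
        locE (TTouch (d := 4) (N := N)) (fun Z : (tsys 4 N).Dom => Z.1)
          (fun Z => ∑ p ∈ terms Z, actOfLetters P Op 𝒴 dom Jc V ℓ p.1 p.2 o h₀) X₀.1‖ ≤
      Real.exp 1 * 9 * 64 * K₀ 64 8 ^ 2 * A * Real.exp (-(r₁ * torusTreeLen X₀.1)) * (μ₀ / (μ₁ - μ₀)) := by
  obtain ⟨hν, hκ, hc⟩ := torus_consts N
  have hK₀ := K₀_four (N := N)
  have h := muPart_locE_le_of_actOfLetters P Op 𝒴 dom Jc V (tsys 4 N) (tgeometry 4 N) ℓ hroom hm hN hq hg hO hH hscale terms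
    (R := R) (b₅ := 5 * r₁) (X₀ := X₀) (sμ := sμ) hA hr₁ (le_of_eq (by ring)) (by rw [hκ]; exact hrate)
    (by rw [hK₀, hν, hc]; exact hsmall) hM3 h0 h01 hμ
  rw [hν, hc, hK₀] at h
  exact h

/-! ## §3 Consistency — the slot ∘ torus square commutes, in kernel -/

open Classical in
/-- (E) THE COMMUTING SQUARE: §2's `attachedPart_locE_le_of_actOfLetters_torus` IS §2's term-dependent cores torus face
`attachedPart_locE_le_of_coresAt_pencil_mass_torus` at `𝔊 k p X := coreOf ℓ p.1 p.2` with the indexing `hact` BY `rfl` and the tables put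
at `h₀ + w` ∕ `h₀` by `simp only [one_smul, zero_smul, add_zero] at h` — N0r §3's own proof transplanted to the torus (slot-then-torus =
torus-then-slot).  This file asserts NO new inequality. [folklore] -/
example {W : Set (ℕ → ℝ)}
    {ctr : ℕ → (ℕ → ℝ) → C.BgB → Op × B13HistM P} {ROp RHist R' : ℕ → ℝ} (ℓ : ∀ Z j, CoreLetters P Op 𝒴 dom Jc V Z j)
    {mq bq N₀ : ℕ → Pol × J → C.Dom → ℝ} (hroom : ∀ k, ROp k < R' k)
    (hm : ∀ k, ∀ g ∈ W, ∀ (U : C.BgB) (X : C.Dom), C.scale X = k → ∀ p, 0 < mq k p X)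
    (hN : ∀ k, ∀ g ∈ W, ∀ (U : C.BgB) (X : C.Dom), C.scale X = k → ∀ p : Pol × J,
      (∀ o ∈ ball (ctr k g U).1 (R' k),
        AEStronglyMeasurable ((ℓ p.1 p.2).N o) (coreOf P Op 𝒴 dom Jc V ℓ p.1 p.2).lam) ∧
      (∀ a, DifferentiableOn ℂ (fun o => (ℓ p.1 p.2).N o a) (ball (ctr k g U).1 (R' k))) ∧
      (∀ o ∈ ball (ctr k g U).1 (R' k), ∀ a, ‖(ℓ p.1 p.2).N o a‖ ≤ N₀ k p X))
    (hq : ∀ k, ∀ g ∈ W, ∀ (U : C.BgB) (X : C.Dom), C.scale X = k → ∀ p : Pol × J,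
      (∀ o ∈ ball (ctr k g U).1 (R' k),
        AEStronglyMeasurable (Function.uncurry ((ℓ p.1 p.2).q o))
          ((coreOf P Op 𝒴 dom Jc V ℓ p.1 p.2).lam.prod volume)) ∧
      (∀ a v, DifferentiableOn ℂ (fun o => (ℓ p.1 p.2).q o a v) (ball (ctr k g U).1 (R' k))) ∧
      (∀ o ∈ ball (ctr k g U).1 (R' k), ∀ a v, mq k p X * ‖v‖ ^ 2 - bq k p X ≤ ((ℓ p.1 p.2).q o a v).re))
    {k : ℕ} {g : ℕ → ℝ} (hg : g ∈ W) {U : C.BgB} {o : Op} {h₀ w : B13HistM P} {ϱ : ℝ}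
    (hO : ‖o - (ctr k g U).1‖ ≤ ROp k) (hH : ‖h₀ - (ctr k g U).2‖ + ϱ * ‖w‖ ≤ RHist k)
    {emb : (tsys 4 N).Dom → C.Dom} (hscale : ∀ Z, C.scale (emb Z) = k) (terms : (tsys 4 N).Dom → Finset (Pol × J))
    {A₀ A₁ R r₁ : ℝ} (X₀ : (tsys 4 N).Dom) (hA₀ : 0 ≤ A₀) (hA₁ : 0 ≤ A₁) (hr₁ : 0 ≤ r₁)
    (hrate : r₁ + 2 * (64 * Real.log 162) + 2 ≤ R)
    (hsmall : (A₀ + ϱ * A₁) * Real.exp (5 * r₁ + 1) * K₀ 64 8 * 9 * 64 ≤ 1)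
    (hM3 : ∀ Z : (tsys 4 N).Dom, Z.1 ⊆ X₀.1 →
      ∑ p ∈ terms Z, (coreOf P Op 𝒴 dom Jc V ℓ p.1 p.2).lam.real univ *
          ((coreOf P Op 𝒴 dom Jc V ℓ p.1 p.2).wB * N₀ k p (emb Z) * Real.exp (bq k p (emb Z))) *
          (Real.pi / (mq k p (emb Z) / 2)) ^ (Module.finrank ℝ (V p.1 p.2) / 2 : ℝ) *
        Real.exp ((coreOf P Op 𝒴 dom Jc V ℓ p.1 p.2).N₁ * (‖h₀‖ + ϱ * ‖w‖)) ≤ (A₀ + ϱ * A₁) * Real.exp (-(R * torusTreeLen Z.1)))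
    (hϱ : 2 ≤ ϱ) (hϱA : A₀ ≤ ϱ * A₁) :
    ‖locE (TTouch (d := 4) (N := N)) (fun Z : (tsys 4 N).Dom => Z.1)
          (fun Z => ∑ p ∈ terms Z, actOfLetters P Op 𝒴 dom Jc V ℓ p.1 p.2 o (h₀ + w)) X₀.1 -
        locE (TTouch (d := 4) (N := N)) (fun Z : (tsys 4 N).Dom => Z.1)
          (fun Z => ∑ p ∈ terms Z, actOfLetters P Op 𝒴 dom Jc V ℓ p.1 p.2 o h₀) X₀.1‖ ≤
      4 * (Real.exp 1 * 9 * 64 * K₀ 64 8 ^ 2) * A₁ * Real.exp (-(r₁ * torusTreeLen X₀.1)) := by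
  have h := attachedPart_locE_le_of_coresAt_pencil_mass_torus (ι := Pol × J)
    (fun (_ : ℕ) (p : Pol × J) (_ : C.Dom) => coreOf P Op 𝒴 dom Jc V ℓ p.1 p.2) hroom hm hN hq hg hO hH hscale
    (terms := terms) (act := fun s Z => ∑ p ∈ terms Z, actOfLetters P Op 𝒴 dom Jc V ℓ p.1 p.2 o (h₀ + s • w))
    (fun _ _ _ => rfl) X₀ hA₀ hA₁ hr₁ hrate hsmall hM3 hϱ hϱA
  simp only [one_smul, zero_smul, add_zero] at h
  exact h

end Slot

end Torus

end Summit.QuantumFields.BalabanUV.T4Continuum.NE1p.DressedSmallFieldOnCoresSlotFaces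

end
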